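import Mathlib
import HarnessLib
import Summits.Ventures.LatticeQCDFlow.Exactness.SU2ResidualSquashStencilVolumeUniform
import Summits.Ventures.LatticeQCDFlow.Exactness.LatticeStencilSmooth

/-!
# THE ENGINE'S PARAMETRISATION WITH A SMOOTH NETWORK, END TO END: for weights `(κ_t/(2(d−1)))·tanh` of a window-stencil network `Ψ` of masked plaquette features `feat` that are smooth ALONG SMOOTH FAMILIES (the pieces, not the composite), FT-HMC through the learned `SU(2)` residual member with the exact force as run converges below ONE trajectory-length threshold `τ₀` on EVERY torus

HONEST FRAMING: exact (Metropolis-corrected) sampling algorithms for lattice gauge theory;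
figures of merit are autocorrelation/cost numbers at stated couplings and volumes; no
continuum-physics claim.

Venture `LatticeQCDFlow` (cell pub-lqcd), topic `Exactness`; FANOUT row 14 (`eng-flowhmc`, engine
`latflow.fthmc`, family B; `maps.residual_scan_rho`: "rho (V, Jn) = (kappa/Jn) tanh(CNN_w(frozen-plaquette
features))", `Jn = 2(D−1)`).  NEW WORK of the cell over the tree (`SU2ResidualSquashStencilVolumeUniform`:
the same conclusion with the composite's smoothness (ρD)/(ρC) as hypotheses; `LatticeStencilSmooth`:
(ρD)/(ρC) from the pieces — `stencilConditioner_family_differentiable/_contDiff`,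
`squashReadout_differentiable/_contDiff`); nothing is cited as a fact; no number.  GEN-17: the last
ANALYTIC hypothesis on the COMPOSITE weight is replaced by hypotheses on the PIECES the engine actually
has — the raw network `Ψ` (readout of the window) and the per-site feature map `feat`:

* **`su2ResidualSmoothStencil_member_fthmcN_exactForce_uniformlyErgodic_allVolumes`** — phase masks of
  width `w > 1`, ANY schedule with `|c_s|·κ_t ≤ κ₀ < 1` (`0 ≤ κ_t`); `feat s c` differentiable / `C^n`
  along every plaquette-array family with differentiable / `C^n` matrix entries (featD)/(featC), `Ψ s μ ν t`
  differentiable / `C^n` along every window family with differentiable / `C^n` entries (ΨD)/(ΨC) — which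
  ordinary smoothness gives by the chain rule (smooth activations: `tanh`, `GELU`, `softplus`; the
  `(Re, Im) tr` features); `feat`, `Ψ` measurable; the frozen-feature property `hfeat`; every
  `β, κ, κ' > 0`: THERE IS `τ₀ > 0` such that FOR EVERY side `L` with `w ∣ L` the learned member exists
  (layers VERBATIM), its exact force is measurable, and for every `n ≥ 1`, `ε' > 0` with `nε' ≤ τ₀` the
  reported `n`-step FT-HMC kernel with the exact force as run converges to
  `wilsonMeasure SU(2).subtype β` from EVERY start, geometrically in total variation.

WHAT REMAINS A HYPOTHESIS, honestly: smoothness of `Ψ` and `feat` in the along-families form (LeakyReLU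
nets are NOT differentiable at the kinks — nothing is claimed for them beyond `nstep = 1`); that the
checkpoint's feature mask is the frozen-plaquette mask (`hfeat`); measurability (automatic for continuous
maps into a Borel `Φ`, kept explicit).  NOT CLAIMED: values of `τ₀`; a volume-uniform rate; longer
trajectories; OMF; floating point; any number.
-/

noncomputable section

namespace Summit.Ventures.LatticeQCDFlow.Exactness

open Set Function MeasureTheory ProbabilityTheory ProbabilityTheory.Kernel InnerProductGeometry WithLp NormedSpace
open Literature.MathematicalPhysics.QuantumFieldTheory
open Literature.MathematicalPhysics.QuantumFieldTheory.Balaban1983to89.B10Eq18SigmaSU2Haar (expPauli)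
open scoped ENNReal Matrix Matrix.Norms.Operator NNReal

set_option backward.isDefEq.respectTransparency false

section Smooth

variable {d : ℕ} {σ : Type*} {Φ : Type*} [NormedAddCommGroup Φ] [NormedSpace ℝ Φ] [MeasurableSpace Φ]

/-- **THE ENGINE'S PARAMETRISATION WITH A SMOOTH NETWORK, END TO END** (`ρ = (κ_t/(2(d−1)))·tanh ∘ Ψ` of
masked window features): every hypothesis of the GEN-16 chain is discharged except smoothness OF THE
PIECES `Ψ`, `feat` along smooth families, their measurability, the refusal budget `|c_s|κ_t ≤ κ₀ < 1`
and the frozen-feature property. -/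
theorem su2ResidualSmoothStencil_member_fthmcN_exactForce_uniformlyErgodic_allVolumes (w : ℕ) [Fact (1 < w)]
    (μf : σ → Fin d) (bf : σ → ZMod w) (cf : σ → ℝ) (m : ℕ)
    (feat : σ → ZMod w → (Fin d → Fin d → Matrix.specialUnitaryGroup (Fin 2) ℂ) → Φ)
    (Ψ : σ → Fin d → Fin d → Fin 2 → ({z : Fin d → ℤ // ∀ i, |z i| ≤ ((m : ℕ) : ℤ)} → Φ) → ℝ)
    {κt : ℝ} (hκt : 0 ≤ κt) {κ₀ : ℝ} (hκ0 : 0 ≤ κ₀) (hκ₀ : κ₀ < 1) (hcκ : ∀ s : σ, |cf s| * κt ≤ κ₀)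
    (hfeatD : ∀ (P : Type) [NormedAddCommGroup P] [NormedSpace ℝ P] (s : σ) (c : ZMod w)
      (Pl : P → Fin d → Fin d → Matrix.specialUnitaryGroup (Fin 2) ℂ) (q₀ : P),
      (∀ μ' ν' : Fin d, DifferentiableAt ℝ (fun q : P => ((Pl q μ' ν' : (Matrix.specialUnitaryGroup (Fin 2) ℂ)) : Matrix (Fin 2) (Fin 2) ℂ)) q₀) →
      DifferentiableAt ℝ (fun q : P => feat s c (Pl q)) q₀)
    (hfeatC : ∀ (P : Type) [NormedAddCommGroup P] [NormedSpace ℝ P] {n : WithTop ℕ∞} (s : σ) (c : ZMod w)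
      (Pl : P → Fin d → Fin d → Matrix.specialUnitaryGroup (Fin 2) ℂ) (q₀ : P),
      (∀ μ' ν' : Fin d, ContDiffAt ℝ n (fun q : P => ((Pl q μ' ν' : (Matrix.specialUnitaryGroup (Fin 2) ℂ)) : Matrix (Fin 2) (Fin 2) ℂ)) q₀) →
      ContDiffAt ℝ n (fun q : P => feat s c (Pl q)) q₀)
    (hΨD : ∀ (P : Type) [NormedAddCommGroup P] [NormedSpace ℝ P] (s : σ) (μ ν : Fin d) (t : Fin 2)
      (G : P → {z : Fin d → ℤ // ∀ i, |z i| ≤ ((m : ℕ) : ℤ)} → Φ) (q₀ : P),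
      (∀ z, DifferentiableAt ℝ (fun q : P => G q z) q₀) → DifferentiableAt ℝ (fun q : P => Ψ s μ ν t (G q)) q₀)
    (hΨC : ∀ (P : Type) [NormedAddCommGroup P] [NormedSpace ℝ P] {n : WithTop ℕ∞} (s : σ) (μ ν : Fin d) (t : Fin 2)
      (G : P → {z : Fin d → ℤ // ∀ i, |z i| ≤ ((m : ℕ) : ℤ)} → Φ) (q₀ : P),
      (∀ z, ContDiffAt ℝ n (fun q : P => G q z) q₀) → ContDiffAt ℝ n (fun q : P => Ψ s μ ν t (G q)) q₀)
    (hfeatm : ∀ (s : σ) (c : ZMod w), Measurable (feat s c))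
    (hΨm : ∀ (s : σ) (μ ν : Fin d) (t : Fin 2), Measurable (Ψ s μ ν t))
    (hfeat : ∀ (s : σ) (c : ZMod w) (P P' : Fin d → Fin d → Matrix.specialUnitaryGroup (Fin 2) ℂ),
      (∀ μ' ν' : Fin d, μ' ≠ ν' → ((μf s ≠ μ' ∧ μf s ≠ ν') ∨ (c ≠ bf s ∧ c + 1 ≠ bf s)) → P μ' ν' = P' μ' ν') →
      feat s c P = feat s c P')
    (sched : List σ) (β κ : ℝ) {κ' : ℝ} (hκ' : 0 < κ') :
    ∃ τ₀ : ℝ, 0 < τ₀ ∧ ∀ (L : ℕ) [NeZero L] (hwL : w ∣ L),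
    ∃ layers : List ((GaugeConfig d L (Matrix.specialUnitaryGroup (Fin 2) ℂ) ≃ᵐ GaugeConfig d L (Matrix.specialUnitaryGroup (Fin 2) ℂ)) × (GaugeConfig d L (Matrix.specialUnitaryGroup (Fin 2) ℂ) → ℝ)),
      layers.map (fun Ly => ((Ly.1 : GaugeConfig d L (Matrix.specialUnitaryGroup (Fin 2) ℂ) → GaugeConfig d L (Matrix.specialUnitaryGroup (Fin 2) ℂ)), Ly.2)) =
        sched.map (fun s =>
          ((fun (V : GaugeConfig d L (Matrix.specialUnitaryGroup (Fin 2) ℂ)) (e : Edge d L) =>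
        if e.2 = μf s ∧ (ZMod.castHom hwL (ZMod w) (∑ j, e.1 j)) = bf s then
          gaussUnit (geodesicKick (cf s) (∑ ν ∈ Finset.univ.erase e.2,
            (((fun s μ ν t F => κt / (2 * ((d - 1 : ℕ) : ℝ)) * Real.tanh (Ψ s μ ν t F)) s e.2 ν 0 (fun z : {z : Fin d → ℤ // ∀ i, |z i| ≤ ((m : ℕ) : ℤ)} =>
          feat s (ZMod.cast (∑ j, (e.1 + (fun i => ((z.1 i : ℤ) : ZMod L))) j) : ZMod w) (fun μ' ν' => plaquetteHolonomy V (e.1 + (fun i => ((z.1 i : ℤ) : ZMod L))) μ' ν'))) • vecQuat (((V (Site.shift e.1 e.2, ν) * (V (Site.shift e.1 ν, e.2))⁻¹ * (V (e.1, ν))⁻¹)⁻¹ : Matrix.specialUnitaryGroup (Fin 2) ℂ) : Matrix (Fin 2) (Fin 2) ℂ) +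
              ((fun s μ ν t F => κt / (2 * ((d - 1 : ℕ) : ℝ)) * Real.tanh (Ψ s μ ν t F)) s e.2 ν 1 (fun z : {z : Fin d → ℤ // ∀ i, |z i| ≤ ((m : ℕ) : ℤ)} =>
          feat s (ZMod.cast (∑ j, (e.1 + (fun i => ((z.1 i : ℤ) : ZMod L))) j) : ZMod w) (fun μ' ν' => plaquetteHolonomy V (e.1 + (fun i => ((z.1 i : ℤ) : ZMod L))) μ' ν'))) • vecQuat ((((V (Site.shift (e.1 - Pi.single ν 1) e.2, ν))⁻¹ * (V (e.1 - Pi.single ν 1, e.2))⁻¹ * V (e.1 - Pi.single ν 1, ν))⁻¹ : Matrix.specialUnitaryGroup (Fin 2) ℂ) : Matrix (Fin 2) (Fin 2) ℂ)))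
            (vecQuat ((V e : Matrix.specialUnitaryGroup (Fin 2) ℂ) : Matrix (Fin 2) (Fin 2) ℂ)))
        else V e),
           fun V : GaugeConfig d L (Matrix.specialUnitaryGroup (Fin 2) ℂ) => ∏ a : {e : Edge d L // e.2 = μf s ∧ (ZMod.castHom hwL (ZMod w) (∑ j, e.1 j)) = bf s},
          (if Real.sin (angle (∑ ν ∈ Finset.univ.erase a.1.2,
            (((fun s μ ν t F => κt / (2 * ((d - 1 : ℕ) : ℝ)) * Real.tanh (Ψ s μ ν t F)) s a.1.2 ν 0 (fun z : {z : Fin d → ℤ // ∀ i, |z i| ≤ ((m : ℕ) : ℤ)} =>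
          feat s (ZMod.cast (∑ j, (a.1.1 + (fun i => ((z.1 i : ℤ) : ZMod L))) j) : ZMod w) (fun μ' ν' => plaquetteHolonomy V (a.1.1 + (fun i => ((z.1 i : ℤ) : ZMod L))) μ' ν'))) • vecQuat (((V (Site.shift a.1.1 a.1.2, ν) * (V (Site.shift a.1.1 ν, a.1.2))⁻¹ * (V (a.1.1, ν))⁻¹)⁻¹ : Matrix.specialUnitaryGroup (Fin 2) ℂ) : Matrix (Fin 2) (Fin 2) ℂ) +
              ((fun s μ ν t F => κt / (2 * ((d - 1 : ℕ) : ℝ)) * Real.tanh (Ψ s μ ν t F)) s a.1.2 ν 1 (fun z : {z : Fin d → ℤ // ∀ i, |z i| ≤ ((m : ℕ) : ℤ)} =>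
          feat s (ZMod.cast (∑ j, (a.1.1 + (fun i => ((z.1 i : ℤ) : ZMod L))) j) : ZMod w) (fun μ' ν' => plaquetteHolonomy V (a.1.1 + (fun i => ((z.1 i : ℤ) : ZMod L))) μ' ν'))) • vecQuat ((((V (Site.shift (a.1.1 - Pi.single ν 1) a.1.2, ν))⁻¹ * (V (a.1.1 - Pi.single ν 1, a.1.2))⁻¹ * V (a.1.1 - Pi.single ν 1, ν))⁻¹ : Matrix.specialUnitaryGroup (Fin 2) ℂ) : Matrix (Fin 2) (Fin 2) ℂ))) (vecQuat ((V a.1 : Matrix.specialUnitaryGroup (Fin 2) ℂ) : Matrix (Fin 2) (Fin 2) ℂ))) = 0 then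
            (1 - cf s * ‖(∑ ν ∈ Finset.univ.erase a.1.2,
            (((fun s μ ν t F => κt / (2 * ((d - 1 : ℕ) : ℝ)) * Real.tanh (Ψ s μ ν t F)) s a.1.2 ν 0 (fun z : {z : Fin d → ℤ // ∀ i, |z i| ≤ ((m : ℕ) : ℤ)} =>
          feat s (ZMod.cast (∑ j, (a.1.1 + (fun i => ((z.1 i : ℤ) : ZMod L))) j) : ZMod w) (fun μ' ν' => plaquetteHolonomy V (a.1.1 + (fun i => ((z.1 i : ℤ) : ZMod L))) μ' ν'))) • vecQuat (((V (Site.shift a.1.1 a.1.2, ν) * (V (Site.shift a.1.1 ν, a.1.2))⁻¹ * (V (a.1.1, ν))⁻¹)⁻¹ : Matrix.specialUnitaryGroup (Fin 2) ℂ) : Matrix (Fin 2) (Fin 2) ℂ) +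
              ((fun s μ ν t F => κt / (2 * ((d - 1 : ℕ) : ℝ)) * Real.tanh (Ψ s μ ν t F)) s a.1.2 ν 1 (fun z : {z : Fin d → ℤ // ∀ i, |z i| ≤ ((m : ℕ) : ℤ)} =>
          feat s (ZMod.cast (∑ j, (a.1.1 + (fun i => ((z.1 i : ℤ) : ZMod L))) j) : ZMod w) (fun μ' ν' => plaquetteHolonomy V (a.1.1 + (fun i => ((z.1 i : ℤ) : ZMod L))) μ' ν'))) • vecQuat ((((V (Site.shift (a.1.1 - Pi.single ν 1) a.1.2, ν))⁻¹ * (V (a.1.1 - Pi.single ν 1, a.1.2))⁻¹ * V (a.1.1 - Pi.single ν 1, ν))⁻¹ : Matrix.specialUnitaryGroup (Fin 2) ℂ) : Matrix (Fin 2) (Fin 2) ℂ)))‖ * Real.cos (angle (∑ ν ∈ Finset.univ.erase a.1.2,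
            (((fun s μ ν t F => κt / (2 * ((d - 1 : ℕ) : ℝ)) * Real.tanh (Ψ s μ ν t F)) s a.1.2 ν 0 (fun z : {z : Fin d → ℤ // ∀ i, |z i| ≤ ((m : ℕ) : ℤ)} =>
          feat s (ZMod.cast (∑ j, (a.1.1 + (fun i => ((z.1 i : ℤ) : ZMod L))) j) : ZMod w) (fun μ' ν' => plaquetteHolonomy V (a.1.1 + (fun i => ((z.1 i : ℤ) : ZMod L))) μ' ν'))) • vecQuat (((V (Site.shift a.1.1 a.1.2, ν) * (V (Site.shift a.1.1 ν, a.1.2))⁻¹ * (V (a.1.1, ν))⁻¹)⁻¹ : Matrix.specialUnitaryGroup (Fin 2) ℂ) : Matrix (Fin 2) (Fin 2) ℂ) +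
              ((fun s μ ν t F => κt / (2 * ((d - 1 : ℕ) : ℝ)) * Real.tanh (Ψ s μ ν t F)) s a.1.2 ν 1 (fun z : {z : Fin d → ℤ // ∀ i, |z i| ≤ ((m : ℕ) : ℤ)} =>
          feat s (ZMod.cast (∑ j, (a.1.1 + (fun i => ((z.1 i : ℤ) : ZMod L))) j) : ZMod w) (fun μ' ν' => plaquetteHolonomy V (a.1.1 + (fun i => ((z.1 i : ℤ) : ZMod L))) μ' ν'))) • vecQuat ((((V (Site.shift (a.1.1 - Pi.single ν 1) a.1.2, ν))⁻¹ * (V (a.1.1 - Pi.single ν 1, a.1.2))⁻¹ * V (a.1.1 - Pi.single ν 1, ν))⁻¹ : Matrix.specialUnitaryGroup (Fin 2) ℂ) : Matrix (Fin 2) (Fin 2) ℂ))) (vecQuat ((V a.1 : Matrix.specialUnitaryGroup (Fin 2) ℂ) : Matrix (Fin 2) (Fin 2) ℂ)))) ^ 3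
          else kickJac (cf s * ‖(∑ ν ∈ Finset.univ.erase a.1.2,
            (((fun s μ ν t F => κt / (2 * ((d - 1 : ℕ) : ℝ)) * Real.tanh (Ψ s μ ν t F)) s a.1.2 ν 0 (fun z : {z : Fin d → ℤ // ∀ i, |z i| ≤ ((m : ℕ) : ℤ)} =>
          feat s (ZMod.cast (∑ j, (a.1.1 + (fun i => ((z.1 i : ℤ) : ZMod L))) j) : ZMod w) (fun μ' ν' => plaquetteHolonomy V (a.1.1 + (fun i => ((z.1 i : ℤ) : ZMod L))) μ' ν'))) • vecQuat (((V (Site.shift a.1.1 a.1.2, ν) * (V (Site.shift a.1.1 ν, a.1.2))⁻¹ * (V (a.1.1, ν))⁻¹)⁻¹ : Matrix.specialUnitaryGroup (Fin 2) ℂ) : Matrix (Fin 2) (Fin 2) ℂ) +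
              ((fun s μ ν t F => κt / (2 * ((d - 1 : ℕ) : ℝ)) * Real.tanh (Ψ s μ ν t F)) s a.1.2 ν 1 (fun z : {z : Fin d → ℤ // ∀ i, |z i| ≤ ((m : ℕ) : ℤ)} =>
          feat s (ZMod.cast (∑ j, (a.1.1 + (fun i => ((z.1 i : ℤ) : ZMod L))) j) : ZMod w) (fun μ' ν' => plaquetteHolonomy V (a.1.1 + (fun i => ((z.1 i : ℤ) : ZMod L))) μ' ν'))) • vecQuat ((((V (Site.shift (a.1.1 - Pi.single ν 1) a.1.2, ν))⁻¹ * (V (a.1.1 - Pi.single ν 1, a.1.2))⁻¹ * V (a.1.1 - Pi.single ν 1, ν))⁻¹ : Matrix.specialUnitaryGroup (Fin 2) ℂ) : Matrix (Fin 2) (Fin 2) ℂ)))‖) 2 (angle (∑ ν ∈ Finset.univ.erase a.1.2,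
            (((fun s μ ν t F => κt / (2 * ((d - 1 : ℕ) : ℝ)) * Real.tanh (Ψ s μ ν t F)) s a.1.2 ν 0 (fun z : {z : Fin d → ℤ // ∀ i, |z i| ≤ ((m : ℕ) : ℤ)} =>
          feat s (ZMod.cast (∑ j, (a.1.1 + (fun i => ((z.1 i : ℤ) : ZMod L))) j) : ZMod w) (fun μ' ν' => plaquetteHolonomy V (a.1.1 + (fun i => ((z.1 i : ℤ) : ZMod L))) μ' ν'))) • vecQuat (((V (Site.shift a.1.1 a.1.2, ν) * (V (Site.shift a.1.1 ν, a.1.2))⁻¹ * (V (a.1.1, ν))⁻¹)⁻¹ : Matrix.specialUnitaryGroup (Fin 2) ℂ) : Matrix (Fin 2) (Fin 2) ℂ) +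
              ((fun s μ ν t F => κt / (2 * ((d - 1 : ℕ) : ℝ)) * Real.tanh (Ψ s μ ν t F)) s a.1.2 ν 1 (fun z : {z : Fin d → ℤ // ∀ i, |z i| ≤ ((m : ℕ) : ℤ)} =>
          feat s (ZMod.cast (∑ j, (a.1.1 + (fun i => ((z.1 i : ℤ) : ZMod L))) j) : ZMod w) (fun μ' ν' => plaquetteHolonomy V (a.1.1 + (fun i => ((z.1 i : ℤ) : ZMod L))) μ' ν'))) • vecQuat ((((V (Site.shift (a.1.1 - Pi.single ν 1) a.1.2, ν))⁻¹ * (V (a.1.1 - Pi.single ν 1, a.1.2))⁻¹ * V (a.1.1 - Pi.single ν 1, ν))⁻¹ : Matrix.specialUnitaryGroup (Fin 2) ℂ) : Matrix (Fin 2) (Fin 2) ℂ))) (vecQuat ((V a.1 : Matrix.specialUnitaryGroup (Fin 2) ℂ) : Matrix (Fin 2) (Fin 2) ℂ)))))) ∧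
      ∃ hΦ : Measurable (fun (V : GaugeConfig d L (Matrix.specialUnitaryGroup (Fin 2) ℂ)) (l : Edge d L) => κ • WithLp.toLp 2 (fun i : Fin 3 =>
        fderiv ℝ (fun a : Edge d L → EuclideanSpace ℝ (Fin 3) => β * wilsonAction (Matrix.specialUnitaryGroup (Fin 2) ℂ).subtype ((layers.foldr (fun Ly (F : GaugeConfig d L (Matrix.specialUnitaryGroup (Fin 2) ℂ) ≃ᵐ GaugeConfig d L (Matrix.specialUnitaryGroup (Fin 2) ℂ)) => Ly.1.trans F) (MeasurableEquiv.refl (GaugeConfig d L (Matrix.specialUnitaryGroup (Fin 2) ℂ)))) ((fun l : Edge d L => expPauli (a l)) * V)) - Real.log ((layers.foldr (fun Ly K => fun v => Ly.2 v * K (Ly.1 v)) (fun _ => (1 : ℝ))) ((fun l : Edge d L => expPauli (a l)) * V))) 0 (Pi.single l (EuclideanSpace.single i (1 : ℝ))))),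
      ∀ (n : ℕ) (ε' : ℝ) (_hn : 1 ≤ n) (_hε' : 0 < ε'), n * ε' ≤ τ₀ →
        ∃ k : ℕ, ∃ δ : ℝ, 0 < δ ∧ δ ≤ 1 ∧ ∀ (μ₀ : Measure (GaugeConfig d L (Matrix.specialUnitaryGroup (Fin 2) ℂ))) [IsProbabilityMeasure μ₀] (t : ℕ) (A : Set (GaugeConfig d L (Matrix.specialUnitaryGroup (Fin 2) ℂ))),
          |((fun m : Measure (GaugeConfig d L (Matrix.specialUnitaryGroup (Fin 2) ℂ)) =>
                m.bind (conjKernel (su2LeapfrogHMCN ε' κ' (measurable_halfKick_su2 hΦ ε')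
                  (fun V : GaugeConfig d L (Matrix.specialUnitaryGroup (Fin 2) ℂ) => β * wilsonAction (Matrix.specialUnitaryGroup (Fin 2) ℂ).subtype ((layers.foldr (fun Ly (F : GaugeConfig d L (Matrix.specialUnitaryGroup (Fin 2) ℂ) ≃ᵐ GaugeConfig d L (Matrix.specialUnitaryGroup (Fin 2) ℂ)) => Ly.1.trans F) (MeasurableEquiv.refl (GaugeConfig d L (Matrix.specialUnitaryGroup (Fin 2) ℂ)))) V) - Real.log ((layers.foldr (fun Ly K => fun v => Ly.2 v * K (Ly.1 v)) (fun _ => (1 : ℝ))) V)) n) (layers.foldr (fun Ly (F : GaugeConfig d L (Matrix.specialUnitaryGroup (Fin 2) ℂ) ≃ᵐ GaugeConfig d L (Matrix.specialUnitaryGroup (Fin 2) ℂ)) => Ly.1.trans F) (MeasurableEquiv.refl (GaugeConfig d L (Matrix.specialUnitaryGroup (Fin 2) ℂ))))))^[t] μ₀).real A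
            - (wilsonMeasure (Matrix.specialUnitaryGroup (Fin 2) ℂ).subtype β).real A| ≤ (1 - δ) ^ (t / (k + 1)) :=
  su2ResidualSquashStencil_member_fthmcN_exactForce_uniformlyErgodic_allVolumes (d := d) w μf bf cf m feat Ψ hκt hκ0 hκ₀ hcκ
    (stencilConditioner_family_differentiable w m feat
      (fun s μ ν t F => κt / (2 * ((d - 1 : ℕ) : ℝ)) * Real.tanh (Ψ s μ ν t F)) hfeatD (squashReadout_differentiable κt Ψ hΨD))
    (stencilConditioner_family_contDiff w m feat
      (fun s μ ν t F => κt / (2 * ((d - 1 : ℕ) : ℝ)) * Real.tanh (Ψ s μ ν t F)) hfeatC (squashReadout_contDiff κt Ψ hΨC))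
    hfeatm hΨm hfeat sched β κ hκ'

end Smooth

end Summit.Ventures.LatticeQCDFlow.Exactness
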